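import Summits.CriticalPhenomena.PercolationContinuityZ3.Theorems.PercNearOneGluingNoHeavyQuantEffectiveTargetSteps
import HarnessLib

/-!
# QUANT lane, tolerance pass-through («TOL»): the additive gluing transports and Step V of Kozma–Nitzan's Lemma 10
# under an η-DEFECTIVE additive gluing inequality

builds on p205010 (kernel theorem, internal audit signed; external expert review pending)

Lane `prim-rate` (effectivity audit of `CSH.percolationContinuity_allDimensions`, seat audit-3), deliverable (b)
«quantitative substitutes — what an APPROXIMATE substitute costs downstream» (HOME/SUBSTITUTES.md §TOL).  Support file for the
closed crux `AdditiveGluing` (stmt-CriticalPhenomena-4576): no definitions, no sorries, standard axioms.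

If a substitute for the finite-graph engine delivers the additive gluing inequality only up to an additive defect `η`,
`P(o ↔ A) − t − η ≤ P(o ↔ b)` whenever `P(a ↔ b) ≥ 1 − t` for all `a ∈ A` (hypothesis `hAG` below; `η = 0` is the tree
theorem `AdditiveGluing_proof`), then:
* the three transports of `…QuantAdditiveGluingTransfer.lean` (finite vertex type; finitely supported weights on a countable
  type; target SET with region-internal relay reliability) carry the defect UNCHANGED — they are equalities of the three
  probabilities (`additiveGluing_fintype_defect`, `additiveGluing_finSupp_defect`, `additiveGluing_finSupp_set_defect`; the
  tree proofs verbatim with `AdditiveGluing_proof` replaced by `hAG`);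
* Step V of Lemma 10 in additive form (`Quant.stepV_additive`) carries it with CONSTANT 1: `P(o ↔ B) − 6δ − η ≤ P(o ↔ T)`
  (`stepV_additive_defect`: the gluing hypothesis is consumed once per contraction graph `K_ξ` and averaged with the cylinder
  weights `p_ξ`, which sum to `1`; no sign hypothesis on `η`); an `example` at `η = 0` recovers the tree statement.
Together with the (A)→(B) defect certificate of audit-2 (block-(A) tolerance ⟹ additive-gluing slack `t + η`, constant 1) this
types the lane's sentence «a tolerance in a block-(A) substitute is passed to Lemma 10 additively, constant 1».
[cite: KozmaNitzan2024, §4 Lemma 10, Step V (pp. 21–22); Conjecture 1 (p. 3)]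
-/

noncomputable section

namespace Summit.CriticalPhenomena.PercolationContinuityZ3.Theorems.Quant

namespace Defect

open MeasureTheory Literature.Probability.LatticeModels Literature.Probability.Percolation
  Literature.Probability.Percolation.KozmaNitzan

variable {d : ℕ}

/-! ## The three transports with an additive defect -/

/-- **η-defective additive gluing over every finite vertex type** (relabel along `Fintype.equivFin`; the three
probabilities are transported exactly, so the defect `η` is unchanged).  `η = 0`: `Quant.additiveGluing_fintype`.
builds on p205010 (kernel theorem, internal audit signed; external expert review pending).
[cite: KozmaNitzan2024, Conjecture 1 (p. 3) and Conjecture 3 (p. 15)] -/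
theorem additiveGluing_fintype_defect {η : ℝ}
    (hAG : ∀ (n : ℕ) (w : Sym2 (Fin n) → unitInterval) (A : Finset (Fin n)) (o b : Fin n) (t : ℝ), 0 ≤ t →
      (∀ a ∈ A, 1 - t ≤ (prodBernoulli w).real (openConn a b)) →
      (prodBernoulli w).real (⋃ a ∈ A, openConn o a) - t - η ≤ (prodBernoulli w).real (openConn o b))
    {V : Type*} [Fintype V] (w : Sym2 V → unitInterval) (A : Finset V) (o b : V)
    {t : ℝ} (ht : 0 ≤ t) (hab : ∀ a ∈ A, 1 - t ≤ (prodBernoulli w).real (openConn a b)) :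
    (prodBernoulli w).real (⋃ a ∈ A, openConn o a) - t - η ≤ (prodBernoulli w).real (openConn o b) := by
  classical
  set e := Fintype.equivFin V with he
  have hf : Function.Injective (e.symm : Fin (Fintype.card V) → V) := e.symm.injective
  set w' : Sym2 (Fin (Fintype.card V)) → unitInterval := w ∘ Sym2.map e.symm with hw'
  have hmap := prodBernoulli_map_restrictConfig w hf
  -- transport of the three probabilities
  have key : ∀ x y : V, (prodBernoulli w').real (openConn (e x) (e y)) = (prodBernoulli w).real (openConn x y) := by
    intro x y
    rw [hw', ← hmap, map_measureReal_apply (measurable_restrictConfig _) (measurableSet_openConn_holds _ _),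
      restrictConfig_symm_preimage_openConn]
  have keyU : (prodBernoulli w').real (⋃ a ∈ A.map e.toEmbedding, openConn (e o) a) =
      (prodBernoulli w).real (⋃ a ∈ A, openConn o a) := by
    rw [hw', ← hmap, map_measureReal_apply (measurable_restrictConfig _)
      (Finset.measurableSet_biUnion _ fun a _ => measurableSet_openConn_holds _ _)]
    congr 1
    exact restrictConfig_symm_preimage_biUnion_openConn e o A
  have h1 := hAG (Fintype.card V) w' (A.map e.toEmbedding) (e o) (e b) t ht (by
    intro a ha
    rw [Finset.mem_map_equiv] at ha
    have := hab (e.symm a) ha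
    rwa [← key, Equiv.apply_symm_apply] at this)
  rwa [key, keyU] at h1

/-- **η-defective additive gluing for finitely supported weights on a countable vertex type** (restriction coupling to the
finite graph on `S`, on which the configuration a.s. lives; probabilities transported exactly).  `η = 0`: `Quant.additiveGluing_finSupp`.
builds on p205010 (kernel theorem, internal audit signed; external expert review pending).
[cite: KozmaNitzan2024, Conjecture 1 (p. 3) and Conjecture 3 (p. 15)] -/
theorem additiveGluing_finSupp_defect {η : ℝ}
    (hAG : ∀ (n : ℕ) (w : Sym2 (Fin n) → unitInterval) (A : Finset (Fin n)) (o b : Fin n) (t : ℝ), 0 ≤ t →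
      (∀ a ∈ A, 1 - t ≤ (prodBernoulli w).real (openConn a b)) →
      (prodBernoulli w).real (⋃ a ∈ A, openConn o a) - t - η ≤ (prodBernoulli w).real (openConn o b))
    {V : Type*} [Countable V] (w : Sym2 V → unitInterval) (S : Finset V)
    (hw : ∀ e : Sym2 V, (∃ x ∈ e, x ∉ S) → w e = 0) (A : Finset V) (o b : V)
    (hAS : A ⊆ S) (ho : o ∈ S) (hb : b ∈ S) {t : ℝ} (ht : 0 ≤ t)
    (hab : ∀ a ∈ A, 1 - t ≤ (prodBernoulli w).real (openConn a b)) :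
    (prodBernoulli w).real (⋃ a ∈ A, openConn o a) - t - η ≤ (prodBernoulli w).real (openConn o b) := by
  classical
  set Sset : Set V := ↑S with hSset
  set f : Sset → V := Subtype.val with hf
  have hfi : Function.Injective f := Subtype.val_injective
  set w' : Sym2 Sset → unitInterval := w ∘ Sym2.map f with hw'
  have hmap := prodBernoulli_map_restrictConfig w hfi
  -- a.s. every open pair lies inside `S`
  have hae : ∀ᵐ ω ∂prodBernoulli w, ∀ e ∈ ω, ∀ x ∈ e, x ∈ Sset := by
    have hZ : ({e : Sym2 V | ∃ x ∈ e, x ∉ S}).Countable := Set.to_countable _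
    filter_upwards [prodBernoulli_ae_forall_notMem w hZ fun e he => hw e he] with ω hω e he x hx
    by_contra hxS
    exact hω e ⟨x, hx, hxS⟩ he
  -- transport of connection probabilities
  have key : ∀ (x y : V) (hx : x ∈ Sset) (hy : y ∈ Sset),
      (prodBernoulli w').real (openConn (⟨x, hx⟩ : Sset) ⟨y, hy⟩) = (prodBernoulli w).real (openConn x y) := by
    intro x y hx hy
    rw [hw', ← hmap, map_measureReal_apply (measurable_restrictConfig _) (measurableSet_openConn_holds _ _)]
    refine measureReal_congr ?_
    filter_upwards [hae] with ω hω
    refine propext ⟨fun h' => ?_, fun h' => ?_⟩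
    · exact reachable_map_of_restrictConfig hfi ω h'
    · exact reachable_restrictConfig_subtype_of_reachable hω hx hy h'
  set A' : Finset Sset := A.subtype (· ∈ Sset) with hA'
  have keyU : (prodBernoulli w').real (⋃ a ∈ A', openConn (⟨o, ho⟩ : Sset) a) =
      (prodBernoulli w).real (⋃ a ∈ A, openConn o a) := by
    rw [hw', ← hmap, map_measureReal_apply (measurable_restrictConfig _)
      (Finset.measurableSet_biUnion _ fun a _ => measurableSet_openConn_holds _ _)]
    refine measureReal_congr ?_
    filter_upwards [hae] with ω hω
    change (ω ∈ restrictConfig f ⁻¹' (⋃ a ∈ A', openConn (⟨o, ho⟩ : Sset) a)) =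
      (ω ∈ ⋃ a ∈ A, openConn o a)
    simp only [Set.mem_preimage, Set.mem_iUnion, exists_prop, hA', Finset.mem_subtype, eq_iff_iff]
    constructor
    · rintro ⟨a, ha, h'⟩
      exact ⟨a, ha, reachable_map_of_restrictConfig hfi ω h'⟩
    · rintro ⟨a, ha, h'⟩
      exact ⟨⟨a, hAS ha⟩, ha, reachable_restrictConfig_subtype_of_reachable hω ho (hAS ha) h'⟩
  have h1 := additiveGluing_fintype_defect hAG w' A' (⟨o, ho⟩ : Sset) ⟨b, hb⟩ ht (by
    intro a ha
    rw [hA', Finset.mem_subtype] at ha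
    have := hab a ha
    rwa [← key a b a.2 hb] at this)
  rwa [key, keyU] at h1

/-- **η-defective additive gluing with a target SET and region-internal relay reliability** (wiring `T` to a point; the form
Step V consumes).  `η = 0`: `Quant.additiveGluing_finSupp_set`.
builds on p205010 (kernel theorem, internal audit signed; external expert review pending).
[cite: KozmaNitzan2024, §4 p. 22 and Conjecture 3 (p. 15)] -/
theorem additiveGluing_finSupp_set_defect {η : ℝ}
    (hAG : ∀ (n : ℕ) (w : Sym2 (Fin n) → unitInterval) (A : Finset (Fin n)) (o b : Fin n) (t : ℝ), 0 ≤ t →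
      (∀ a ∈ A, 1 - t ≤ (prodBernoulli w).real (openConn a b)) →
      (prodBernoulli w).real (⋃ a ∈ A, openConn o a) - t - η ≤ (prodBernoulli w).real (openConn o b))
    {V : Type*} [Countable V] (w : Sym2 V → unitInterval) (S : Finset V)
    (hw : ∀ e : Sym2 V, (∃ x ∈ e, x ∉ S) → w e = 0) (A T : Finset V) (o : V) (Rg : Set V)
    (hAS : A ⊆ S) (hTS : T ⊆ S) (ho : o ∈ S) (hT : T.Nonempty) {t : ℝ} (ht : 0 ≤ t)
    (haT : ∀ a ∈ A, 1 - t ≤ (prodBernoulli w).real (⋃ x ∈ T, openConnIn Rg a x)) :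
    (prodBernoulli w).real (⋃ a ∈ A, openConn o a) - t - η ≤ (prodBernoulli w).real (⋃ x ∈ T, openConn o x) := by
  obtain ⟨t₀, ht₀⟩ := hT
  have hw' : ∀ e : Sym2 V, (∃ x ∈ e, x ∉ S) → wireW (↑T : Set V) w e = 0 := by
    intro e he
    rw [wireW_apply_of_not_mem w ?_, hw e he]
    obtain ⟨x, hx, hxS⟩ := he
    exact fun h' => hxS (hTS (h'.1 x hx))
  -- relays are reliable to `t₀` in the wired graph
  have hab : ∀ a ∈ A, 1 - t ≤ (prodBernoulli (wireW (↑T : Set V) w)).real (openConn a t₀) := by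
    intro a ha
    rw [prodBernoulli_wireW_real_openConn w (↑T : Set V) (Finset.mem_coe.2 ht₀) a]
    refine (haT a ha).trans (measureReal_mono (Set.iUnion₂_mono fun x _ ω hω => ?_) (measure_ne_top _ _))
    rw [DCT16.mem_openConnIn_iff_pathIn] at hω
    exact reachable_of_pathIn hω
  have h1 := additiveGluing_finSupp_defect hAG (wireW (↑T : Set V) w) S hw' A o t₀ hAS ho (hTS ht₀) ht hab
  rw [prodBernoulli_wireW_real_openConn w (↑T : Set V) (Finset.mem_coe.2 ht₀) o] at h1
  have hmono := prodBernoulli_real_biUnion_openConn_mono (le_wireW (↑T : Set V) w) o (↑A : Set V)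
  have e1 : (⋃ a ∈ (↑A : Set V), openConn o a : Set (BondConfig V)) = ⋃ a ∈ A, openConn o a := by
    ext ω; simp only [Set.mem_iUnion, Finset.mem_coe]
  have e2 : (⋃ x ∈ (↑T : Set V), openConn o x : Set (BondConfig V)) = ⋃ x ∈ T, openConn o x := by
    ext ω; simp only [Set.mem_iUnion, Finset.mem_coe]
  rw [e1] at hmono
  rw [e2] at h1
  linarith

/-! ## Step V with a defective transported gluing hypothesis -/

open Classical in
/-- **Step V of Lemma 10 (additive form) under an η-defective transported gluing hypothesis**: if every finitely supported
weighting on `L.Sfin` satisfies `μ(o ↔ A) − t − η ≤ μ(o ↔ T)` whenever the relays of `A` are `t`-reliable to `T` inside `Rg`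
(hypothesis `hGlue`; discharged at `η = 0` by `Quant.additiveGluing_finSupp_set`, and for general `η` by
`additiveGluing_finSupp_set_defect`), then with the inputs of `Quant.stepV_additive` (Step II in defect form, the seed bound,
the Step-IV face estimate) `μ(o ↔ B) − 6δ − η ≤ μ(o ↔ T)`.  Proof: the tree's proof of `Quant.stepV_additive` verbatim, the
defect carried through the `p_ξ`-average (total cylinder mass `1`); no hypothesis on the sign of `η`.
builds on p205010 (kernel theorem, internal audit signed; external expert review pending).
[cite: KozmaNitzan2024, §4 pp. 21–22 (Step V, (25)–(26))] -/
theorem stepV_additive_defect [NeZero d] {L : LData d} {W : Sym2 (Site d) → unitInterval} {p : unitInterval}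
    {D : Finset (Site d)} {R : ℕ} (hL : LHyp L W p D R) {Rg : Set (Site d)} {j M k : ℕ} (hj : j ≤ R)
    (hwide : ∀ k, L.Lo j k + 2 * M + 2 ≤ L.Hi j k)
    {S T : Finset (Site d)} (hS : S ⊆ Finset.Icc (L.Lo j + 1) (L.Hi j - 1)) (hSD : S ⊆ D)
    {δ : ℝ} (hδ : 0 < δ) {η : ℝ}
    (hGlue : ∀ (w' : Sym2 (Site d) → unitInterval), (∀ e : Sym2 (Site d), (∃ x ∈ e, x ∉ L.Sfin) → w' e = 0) →
      ∀ (A : Finset (Site d)), A ⊆ L.Sfin → ∀ {t : ℝ}, 0 ≤ t →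
      (∀ a ∈ A, 1 - t ≤ (prodBernoulli w').real (⋃ x ∈ T, openConnIn Rg a x)) →
      (prodBernoulli w').real (⋃ a ∈ A, openConn L.o a) - t - η ≤ (prodBernoulli w').real (⋃ x ∈ T, openConn L.o x))
    (hII : (prodBernoulli W).real L.reachB - δ ≤ (prodBernoulli W).real (L.Fail (LData.Ncont d M k) j)ᶜ)
    (hIII : (1 - (p : ℝ) ^ seedBound d M) ^ k ≤ δ)
    (hUS : ∀ x ∈ outerBoundary (zdGraph d) (L.X j), L.ufaceX j M x ⊆ S)
    (hIV : ∀ x ∈ outerBoundary (zdGraph d) (L.X j),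
      1 - 3 * δ ≤ (prodBernoulli W).real {ω | ∃ u ∈ L.ufaceX j M x,
        1 - δ < (prodBernoulli (pinW W (wireSet (↑S : Set (Site d))) ω)).real (⋃ t ∈ T, openConnIn Rg u t)}) :
    (prodBernoulli W).real L.reachB - 6 * δ - η ≤ (prodBernoulli W).real (⋃ t ∈ T, openConn L.o t) := by
  set μ := prodBernoulli W with hμ
  set OB := outerBoundary (zdGraph d) (L.X j) with hOB
  set F := pairsF S with hF
  have hFS : (↑F : Set (Sym2 (Site d))) = wireSet (↑S : Set (Site d)) := coe_pairsF S
  have hSfin : S ⊆ L.Sfin := hSD.trans hL.DS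
  -- the good sets `A_ξ` and the quantities `φ_ξ`
  set Aof : Finset (Sym2 (Site d)) → Finset (Site d) := fun P => S.filter fun u =>
    1 - δ < (prodBernoulli (pinW W (wireSet (↑S : Set (Site d))) ↑P)).real (⋃ t ∈ T, openConnIn Rg u t) with hAof
  set φ : Finset (Sym2 (Site d)) → ℝ := fun P =>
    (prodBernoulli (pinW W ↑F ↑P)).real (⋃ a ∈ Aof P, openConn L.o a) with hφ
  set cyl : Finset (Sym2 (Site d)) → Set (BondConfig (Site d)) := fun P => localCylinder ↑F ↑P with hcyl
  -- `μ(𝒢) ≥ μ(o ↔ B) - 2δ`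
  have hmG : MeasurableSet (L.Gev j M k) := by
    rw [← LData.biUnion_Fx_eq_Gev]
    exact Finset.measurableSet_biUnion _ fun x hx => LData.measurableSet_Fx hx
  have hG : μ.real L.reachB - 2 * δ ≤ μ.real (L.Gev j M k) := by
    have h1 := hL.real_manyContacts_diff_Gev_le (j := j) (M := M) (k := k) hj hwide
    have h2 : μ.real (L.Fail (LData.Ncont d M k) j)ᶜ ≤
        μ.real ((L.Fail (LData.Ncont d M k) j)ᶜ \ L.Gev j M k) + μ.real (L.Gev j M k) := by
      rw [← measureReal_inter_add_sdiff (s := (L.Fail (LData.Ncont d M k) j)ᶜ) hmG, add_comm]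
      exact add_le_add le_rfl (measureReal_mono Set.inter_subset_right)
    linarith
  have hGle : μ.real (L.Gev j M k) ≤ 1 := measureReal_le_one
  -- Claim D: `Σ_P μ(cyl P) φ(P) ≥ (1 - 3δ) μ(𝒢)` (verbatim from the tree's Step V)
  have hGood_det : ∀ x, DeterminedBy {ω | ∃ u ∈ L.ufaceX j M x,
      1 - δ < (prodBernoulli (pinW W (wireSet (↑S : Set (Site d))) ω)).real (⋃ t ∈ T, openConnIn Rg u t)} ↑F := by
    intro x
    rw [determinedBy_iff]
    intro ω ω' hω
    simp only [Set.mem_setOf_eq]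
    have hag : ∀ e ∈ wireSet (↑S : Set (Site d)), e ∈ ω ↔ e ∈ ω' := by
      intro e he
      rw [← hFS] at he
      have := Set.ext_iff.1 hω e
      simp only [Set.mem_inter_iff] at this
      exact ⟨fun h' => (this.1 ⟨h', he⟩).1, fun h' => (this.2 ⟨h', he⟩).1⟩
    refine exists_congr fun u => and_congr_right fun _ => ?_
    rw [pinW_congr W hag]
  have hFx_pin : ∀ P, ∀ x ∈ OB, (prodBernoulli (pinW W ↑F ↑P)).real (L.Fx j M k x) = μ.real (L.Fx j M k x) := by
    intro P x hx
    rw [hμ]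
    refine (prodBernoulli_real_eq_of_determinedBy W _ (F := (↑F : Set (Sym2 (Site d)))ᶜ)
      (fun e he => (pinW_apply_of_not_mem W ↑P he).symm) ?_ (LData.measurableSet_Fx hx)).symm
    rw [hFS]
    exact LData.determinedBy_Fx hwide hS hx
  have hφ_ge : ∀ P, P ⊆ F →
      ∑ x ∈ OB.filter (fun x => ∃ u ∈ L.ufaceX j M x, u ∈ Aof P), μ.real (L.Fx j M k x) ≤ φ P := by
    intro P hP
    have hsub : (⋃ x ∈ OB.filter (fun x => ∃ u ∈ L.ufaceX j M x, u ∈ Aof P), L.Fx j M k x) ⊆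
        ⋃ a ∈ Aof P, openConn L.o a := by
      intro ω hω
      simp only [Set.mem_iUnion, exists_prop, Finset.mem_filter] at hω ⊢
      obtain ⟨x, ⟨hxO, u, hu, huA⟩, hFx⟩ := hω
      exact ⟨u, huA, LData.openConn_of_mem_oSeed hwide hxO (LData.Fx_subset_oSeed x hFx) hu⟩
    calc _ = ∑ x ∈ OB.filter (fun x => ∃ u ∈ L.ufaceX j M x, u ∈ Aof P),
            (prodBernoulli (pinW W ↑F ↑P)).real (L.Fx j M k x) :=
          Finset.sum_congr rfl fun x hx => (hFx_pin P x (Finset.mem_filter.1 hx).1).symm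
      _ = (prodBernoulli (pinW W ↑F ↑P)).real
            (⋃ x ∈ OB.filter (fun x => ∃ u ∈ L.ufaceX j M x, u ∈ Aof P), L.Fx j M k x) := by
          rw [measureReal_biUnion_finset]
          · intro x hx x' hx' hne
            exact LData.Fx_disjoint hne (Finset.mem_filter.1 hx').1 (Finset.mem_filter.1 hx).1
          · intro x hx; exact LData.measurableSet_Fx (Finset.mem_filter.1 hx).1
      _ ≤ φ P := measureReal_mono hsub (measure_ne_top _ _)
  have hD : (1 - 3 * δ) * μ.real (L.Gev j M k) ≤ ∑ P ∈ F.powerset, μ.real (cyl P) * φ P := by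
    have hGx : ∀ x ∈ OB, μ.real {ω | ∃ u ∈ L.ufaceX j M x,
        1 - δ < (prodBernoulli (pinW W (wireSet (↑S : Set (Site d))) ω)).real (⋃ t ∈ T, openConnIn Rg u t)} =
        ∑ P ∈ F.powerset.filter (fun P => ∃ u ∈ L.ufaceX j M x, u ∈ Aof P), μ.real (cyl P) := by
      intro x hx
      rw [hμ, prodBernoulli_real_eq_sum_localCylinder W F (hGood_det x)]
      refine Finset.sum_congr ?_ fun P _ => rfl
      ext P
      simp only [Finset.mem_filter, Finset.mem_powerset, Set.mem_setOf_eq, hAof, and_congr_right_iff]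
      intro _
      constructor
      · rintro ⟨u, hu, hg⟩; exact ⟨u, hu, hUS x hx hu, hg⟩
      · rintro ⟨u, hu, -, hg⟩; exact ⟨u, hu, hg⟩
    calc (1 - 3 * δ) * μ.real (L.Gev j M k)
        = ∑ x ∈ OB, (1 - 3 * δ) * μ.real (L.Fx j M k x) := by
          rw [← LData.biUnion_Fx_eq_Gev, measureReal_biUnion_finset, Finset.mul_sum]
          · intro x hx x' hx' hne; exact LData.Fx_disjoint hne hx' hx
          · intro x hx; exact LData.measurableSet_Fx hx
      _ ≤ ∑ x ∈ OB, μ.real {ω | ∃ u ∈ L.ufaceX j M x,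
            1 - δ < (prodBernoulli (pinW W (wireSet (↑S : Set (Site d))) ω)).real (⋃ t ∈ T, openConnIn Rg u t)} *
            μ.real (L.Fx j M k x) :=
          Finset.sum_le_sum fun x hx => mul_le_mul_of_nonneg_right (hIV x hx) measureReal_nonneg
      _ = ∑ x ∈ OB, ∑ P ∈ F.powerset.filter (fun P => ∃ u ∈ L.ufaceX j M x, u ∈ Aof P),
            μ.real (cyl P) * μ.real (L.Fx j M k x) := by
          refine Finset.sum_congr rfl fun x hx => ?_
          rw [hGx x hx, Finset.sum_mul]
      _ = ∑ P ∈ F.powerset, ∑ x ∈ OB.filter (fun x => ∃ u ∈ L.ufaceX j M x, u ∈ Aof P),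
            μ.real (cyl P) * μ.real (L.Fx j M k x) := by
          rw [Finset.sum_comm' (t' := F.powerset)
            (s' := fun P => OB.filter (fun x => ∃ u ∈ L.ufaceX j M x, u ∈ Aof P))]
          intro x P
          simp only [Finset.mem_filter, Finset.mem_powerset]
          tauto
      _ = ∑ P ∈ F.powerset, μ.real (cyl P) *
            ∑ x ∈ OB.filter (fun x => ∃ u ∈ L.ufaceX j M x, u ∈ Aof P), μ.real (L.Fx j M k x) := by
          refine Finset.sum_congr rfl fun P _ => ?_
          rw [Finset.mul_sum]
      _ ≤ ∑ P ∈ F.powerset, μ.real (cyl P) * φ P :=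
          Finset.sum_le_sum fun P hP => mul_le_mul_of_nonneg_left (hφ_ge P (Finset.mem_powerset.1 hP)) measureReal_nonneg
  -- total mass of the cylinders is `1`
  have hcyl_sum : ∑ P ∈ F.powerset, μ.real (cyl P) = 1 := by
    have := prodBernoulli_real_eq_sum_localCylinder W F (determinedBy_univ (↑F : Set (Sym2 (Site d))))
    rw [probReal_univ] at this
    rw [hμ, this]
    refine (Finset.sum_congr ?_ fun P _ => rfl)
    ext P; simp
  -- ADDITIVE gluing in every contraction graph `K_ξ`
  have hF : ∀ P ∈ F.powerset,
      φ P - δ - η ≤ (prodBernoulli (pinW W ↑F ↑P)).real (⋃ t ∈ T, openConn L.o t) := by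
    intro P _
    have hsupp : FinSupp (pinW W ↑F ↑P) L.Sfin := by rw [hFS]; exact hL.finSupp_pinW hSfin ↑P
    refine hGlue (pinW W ↑F ↑P) hsupp.zero (Aof P)
      ((Finset.filter_subset _ _).trans hSfin) hδ.le fun a ha => ?_
    have hga := (Finset.mem_filter.1 ha).2
    rw [← hFS] at hga
    exact hga.le
  -- conclusion: total probability over the patterns
  have hmT : MeasurableSet (⋃ t ∈ T, openConn L.o t : Set (BondConfig (Site d))) :=
    Finset.measurableSet_biUnion _ fun t _ => measurableSet_openConn_holds _ _
  have htot := prodBernoulli_real_inter_eq_sum_pinW W F hmT (determinedBy_univ (↑F : Set (Sym2 (Site d))))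
  rw [Set.inter_univ] at htot
  simp only [Set.mem_univ, Finset.filter_true] at htot
  have hsum_ge : ∑ P ∈ F.powerset, μ.real (cyl P) * φ P - δ - η ≤
      ∑ P ∈ F.powerset, μ.real (cyl P) * (prodBernoulli (pinW W ↑F ↑P)).real (⋃ t ∈ T, openConn L.o t) := by
    have h1 : ∑ P ∈ F.powerset, μ.real (cyl P) * (φ P - δ - η) ≤
        ∑ P ∈ F.powerset, μ.real (cyl P) * (prodBernoulli (pinW W ↑F ↑P)).real (⋃ t ∈ T, openConn L.o t) :=
      Finset.sum_le_sum fun P hP => mul_le_mul_of_nonneg_left (hF P hP) measureReal_nonneg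
    have h2 : ∑ P ∈ F.powerset, μ.real (cyl P) * (φ P - δ - η) =
        ∑ P ∈ F.powerset, μ.real (cyl P) * φ P - δ - η := by
      simp only [mul_sub, Finset.sum_sub_distrib, ← Finset.sum_mul, hcyl_sum, one_mul]
    linarith
  have h3δ : μ.real (L.Gev j M k) - 3 * δ ≤ (1 - 3 * δ) * μ.real (L.Gev j M k) := by nlinarith
  rw [hμ] at hsum_ge
  rw [htot]
  linarith

open Classical in
/- **Consistency at `η = 0`** (an `example`, not a declaration: its type IS the tree's `Quant.stepV_additive`, which the gate's
dedup lint would otherwise flag): `hGlue` is then discharged by `Quant.additiveGluing_finSupp_set`, and the conclusion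
`μ(o ↔ B) − 6δ ≤ μ(o ↔ T)` of `Quant.stepV_additive` follows — the hypothesis shape of `stepV_additive_defect` is exactly what
the tree discharges. -/
example [NeZero d] {L : LData d} {W : Sym2 (Site d) → unitInterval} {p : unitInterval}
    {D : Finset (Site d)} {R : ℕ} (hL : LHyp L W p D R) {Rg : Set (Site d)} {j M k : ℕ} (hj : j ≤ R)
    (hwide : ∀ k, L.Lo j k + 2 * M + 2 ≤ L.Hi j k)
    {S T : Finset (Site d)} (hS : S ⊆ Finset.Icc (L.Lo j + 1) (L.Hi j - 1)) (hSD : S ⊆ D)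
    (hTS : T ⊆ L.Sfin) (hTne : T.Nonempty) {δ : ℝ} (hδ : 0 < δ)
    (hII : (prodBernoulli W).real L.reachB - δ ≤ (prodBernoulli W).real (L.Fail (LData.Ncont d M k) j)ᶜ)
    (hIII : (1 - (p : ℝ) ^ seedBound d M) ^ k ≤ δ)
    (hUS : ∀ x ∈ outerBoundary (zdGraph d) (L.X j), L.ufaceX j M x ⊆ S)
    (hIV : ∀ x ∈ outerBoundary (zdGraph d) (L.X j),
      1 - 3 * δ ≤ (prodBernoulli W).real {ω | ∃ u ∈ L.ufaceX j M x,
        1 - δ < (prodBernoulli (pinW W (wireSet (↑S : Set (Site d))) ω)).real (⋃ t ∈ T, openConnIn Rg u t)}) :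
    (prodBernoulli W).real L.reachB - 6 * δ ≤ (prodBernoulli W).real (⋃ t ∈ T, openConn L.o t) := by
  have h := stepV_additive_defect hL hj hwide hS hSD hδ (η := 0)
    (fun w' hw' A hA t ht haT => by
      have := additiveGluing_finSupp_set w' L.Sfin hw' A T L.o Rg hA hTS hL.o_mem hTne ht haT
      linarith)
    hII hIII hUS hIV
  linarith

end Defect

end Summit.CriticalPhenomena.PercolationContinuityZ3.Theorems.Quant

end
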